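import Summits.QuantumAdvantage.QuantumAdvantage.Theorems.LinnikCubicClassGroupsDegreeOnePrimesEscapeDivisionPNTThresholds
import Summits.QuantumAdvantage.QuantumAdvantage.Theorems.LinnikCubicClassGroupsDegreeOnePrimesEscapeDivisionMainTerm
import HarnessLib

/-!
# The Möbius combination of subfield prime ideal theorems, two-sided, at every `x ≥ |d_N|^L`

Topic `Summits/QuantumAdvantage/QuantumAdvantage/Theorems`, cell B2b-1 (linnik-cubic), PART A (gen 10);
helper toward the crux `DegreeOnePrimesEscape` (stmt-QuantumAdvantage-11543) of route
`LinnikCubicClassGroups`.  HONEST FRAMING: the value of this file is a THEOREM (kernel-checked, GRH-free,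
Siegel-free, no hypothesis) — NOT summit progress.

Let `N/ℚ` be Galois of degree `n`, `σ ∈ Gal(N/ℚ)` of order `m`, `E_t = N^{⟨σ^t⟩}`, `M = Σ_{t ∣ m} μ(t)/t`,
`T(x) = Σ_{t ∣ m} (μ(t)/t) θ¹_{E_t}(x)`, `d = |d_N|`.  `…ChebotarevDivision.lean` bounded `T(|d_N|^L)` from
BELOW.  Here `T(x)` is evaluated with RELATIVE ERROR `ε` at EVERY `x ≥ d^{L(n,ε)}`
(`divisionTheta_twoSided`): with the window constant `c = c(n, ε) ≤ 1/4`,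

* (A) if `ζ_N` has no real zero in `(1 − c/(log d + log 4), 1)`: `|T(x) − M x| ≤ ε M x`;
* (B) if `β₁` is such a zero and `y = x^{β₁}/β₁`: `|T(x) − M (x − y)| ≤ ε M (x − y)` (and `x − y > 0`) when
  `ζ_{N^{⟨σ⟩}}(β₁) = 0`, and `|T(x) − M (x + y)| ≤ ε M (x + y)` when `ζ_{N^{⟨σ⟩}}(β₁) ≠ 0`.

The sign is Heilbronn–Stark's (`ζ_{N^H}(β₁) = 0 ↔ H ≤ K₁`, `K₁` of index two, `…DivisionZeros.lean`), so
`ζ_{N^{⟨σ⟩}}(β₁) = 0 ↔ σ ∈ K₁ ↔ χ_{K₁}(σ) = +1`.  Inputs: the uniform / pointed subfield prime ideal theorems of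
`…DivisionTheta.lean` (Deuring–Heilbronn class PNT), Landau–Page for `ζ_N`, Stark (`…DivisionMainTerm.lean`).
References: Lagarias–Montgomery–Odlyzko, Invent. Math. 54 (1979) [LagariasMontgomeryOdlyzko1979]; Thorner–Zaman,
Algebra Number Theory 13 (2019), Thm 1.4 (shape of the relative error) [ThornerZaman2019].
-/

noncomputable section

open scoped NumberField nonZeroDivisors
open Finset Real Ideal NumberField
open Literature.NumberTheory.NumberFields Literature.NumberTheory.LFunctions
  Literature.NumberTheory.LFunctions.NumberField

namespace Summit.QuantumAdvantage.QuantumAdvantage.Theorems.DegreeOnePrimesEscape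

/-! ### The final arithmetic of the three cases -/

/-- Cases with main term `≥ M x`: `n · (2ηx + x^{3/4} + log d) ≤ ε M x'` for `x ≤ x'`. -/
theorem division_conclusion_main {n : ℕ} (hn : 1 < n) {ε x x' M J ℓ : ℝ} (hε : 0 < ε) (hx : 0 < x)
    (hxx' : x ≤ x') (hM : 1 / (n : ℝ) ^ 2 ≤ M)
    (hJ : (n : ℝ) * J ≤ ε * x / (4 * n ^ 2)) (hℓ : ((n : ℝ) ^ 2 + n) * ℓ ≤ ε * x / (4 * n ^ 2)) (hℓ0 : 0 ≤ ℓ) :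
    (n : ℝ) * (2 * (ε / (16 * n ^ 3)) * x + J + ℓ) ≤ ε * (M * x') := by
  have hn0 : (0 : ℝ) < n := by exact_mod_cast lt_trans Nat.zero_lt_one hn
  have hn1 : (1 : ℝ) ≤ n := by exact_mod_cast hn.le
  have e1 : (n : ℝ) * (2 * (ε / (16 * n ^ 3)) * x) = ε * x / (8 * n ^ 2) := by
    field_simp; ring
  have hℓ' : (n : ℝ) * ℓ ≤ ε * x / (4 * n ^ 2) := by
    have : (n : ℝ) * ℓ ≤ ((n : ℝ) ^ 2 + n) * ℓ := by nlinarith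
    linarith
  have hMx : ε * x / n ^ 2 ≤ ε * (M * x') := by
    have h1 : ε * x / n ^ 2 = ε * ((1 / n ^ 2) * x) := by field_simp
    rw [h1]
    apply mul_le_mul_of_nonneg_left _ hε.le
    exact mul_le_mul hM hxx' hx.le (le_trans (by positivity) hM)
  have e2 : ε * x / (8 * (n : ℝ) ^ 2) + ε * x / (4 * n ^ 2) + ε * x / (4 * n ^ 2) ≤ ε * x / n ^ 2 := by
    have : ε * x / (8 * (n : ℝ) ^ 2) + ε * x / (4 * n ^ 2) + ε * x / (4 * n ^ 2) = (5 / 8) * (ε * x / n ^ 2) := by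
      field_simp; ring
    rw [this]; linarith [show 0 ≤ ε * x / n ^ 2 by positivity]
  calc (n : ℝ) * (2 * (ε / (16 * n ^ 3)) * x + J + ℓ)
      = (n : ℝ) * (2 * (ε / (16 * n ^ 3)) * x) + n * J + n * ℓ := by ring
    _ ≤ ε * x / (8 * n ^ 2) + ε * x / (4 * n ^ 2) + ε * x / (4 * n ^ 2) := by rw [e1]; linarith
    _ ≤ ε * (M * x') := e2.trans hMx

/-- Case with main term `M (x − y) ≥ M W`: `n · (η (x−y) + x^{3/4}) ≤ ε M (x − y)`. -/
theorem division_conclusion_exc {n : ℕ} (hn : 1 < n) {ε v W M J : ℝ} (hε : 0 < ε) (hv : 0 < v)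
    (hWv : W ≤ v) (hM : 1 / (n : ℝ) ^ 2 ≤ M) (hJ : (n : ℝ) * J ≤ ε * W / (4 * n ^ 2)) :
    (n : ℝ) * (ε / (16 * n ^ 3) * v + J) ≤ ε * (M * v) := by
  have hn0 : (0 : ℝ) < n := by exact_mod_cast lt_trans Nat.zero_lt_one hn
  have e1 : (n : ℝ) * (ε / (16 * n ^ 3) * v) = ε * v / (16 * n ^ 2) := by
    field_simp
  have hJ' : (n : ℝ) * J ≤ ε * v / (4 * n ^ 2) := by
    have : ε * W / (4 * (n : ℝ) ^ 2) ≤ ε * v / (4 * n ^ 2) := by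
      apply div_le_div_of_nonneg_right _ (by positivity)
      exact mul_le_mul_of_nonneg_left hWv hε.le
    linarith
  have hMv : ε * v / n ^ 2 ≤ ε * (M * v) := by
    have h1 : ε * v / n ^ 2 = ε * ((1 / n ^ 2) * v) := by field_simp
    rw [h1]
    apply mul_le_mul_of_nonneg_left _ hε.le
    exact mul_le_mul_of_nonneg_right hM hv.le
  have e2 : ε * v / (16 * (n : ℝ) ^ 2) + ε * v / (4 * n ^ 2) ≤ ε * v / n ^ 2 := by
    have : ε * v / (16 * (n : ℝ) ^ 2) + ε * v / (4 * n ^ 2) = (5 / 16) * (ε * v / n ^ 2) := by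
      field_simp; ring
    rw [this]; linarith [show 0 ≤ ε * v / n ^ 2 by positivity]
  calc (n : ℝ) * (ε / (16 * n ^ 3) * v + J) = (n : ℝ) * (ε / (16 * n ^ 3) * v) + n * J := by ring
    _ ≤ ε * v / (16 * n ^ 2) + ε * v / (4 * n ^ 2) := by rw [e1]; linarith
    _ ≤ ε * (M * v) := e2.trans hMv

set_option maxHeartbeats 6000000 in
open scoped Classical in
/-- **The Möbius combination of the subfield prime ideal theorems, two-sided, at every `x ≥ |d_N|^L`**
(notation of the module docstring): for `n > 1`, `0 < ε ≤ 1` there are `L > 0`, `0 < c ≤ 1/4` such that for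
every Galois `N` of degree `n`, every `σ`, `d = |d_N|`: (A) if `ζ_N` has no real zero in `(1 − c/(log d + log 4), 1)`
then `|T(x) − M x| ≤ ε M x` for all `x ≥ d^L`; (B) if `β₁` is such a zero then, with `y = x^{β₁}/β₁`, for all
`x ≥ d^L`: `0 < x − y` and `|T(x) − M(x − y)| ≤ ε M (x − y)` if `ζ_{N^{⟨σ⟩}}(β₁) = 0`, and
`|T(x) − M(x + y)| ≤ ε M (x + y)` if `ζ_{N^{⟨σ⟩}}(β₁) ≠ 0`.  Unconditional.
[cite: LagariasMontgomeryOdlyzko1979, Theorem 1.1] [cite: ThornerZaman2019, Theorem 1.4] -/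
theorem divisionTheta_twoSided (n : ℕ) (hn : 1 < n) {ε : ℝ} (hε : 0 < ε) (hε1 : ε ≤ 1) :
    ∃ L c : ℝ, 0 < L ∧ 0 < c ∧ c ≤ 1 / 4 ∧ ∀ (N : Type) [Field N] [NumberField N] [IsGalois ℚ N],
      Module.finrank ℚ N = n → ∀ σ : N ≃ₐ[ℚ] N,
        ((¬ ∃ β₁ : ℝ, dedekindZeta₁ N β₁ = 0 ∧
            1 - c / (Real.log ((NumberField.discr N).natAbs : ℝ) + Real.log 4) < β₁ ∧ β₁ < 1) →
          ∀ x : ℝ, ((NumberField.discr N).natAbs : ℝ) ^ L ≤ x →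
            |∑ t ∈ (orderOf σ).divisors, (ArithmeticFunction.moebius t : ℝ) / t *
                degreeOneTheta (IntermediateField.fixedField (Subgroup.zpowers (σ ^ t))) x -
              (∑ t ∈ (orderOf σ).divisors, (ArithmeticFunction.moebius t : ℝ) / t) * x| ≤
              ε * ((∑ t ∈ (orderOf σ).divisors, (ArithmeticFunction.moebius t : ℝ) / t) * x)) ∧
        (∀ β₁ : ℝ, dedekindZeta₁ N β₁ = 0 →
          1 - c / (Real.log ((NumberField.discr N).natAbs : ℝ) + Real.log 4) < β₁ → β₁ < 1 →
          (dedekindZeta₁ (IntermediateField.fixedField (Subgroup.zpowers σ)) β₁ = 0 →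
            ∀ x : ℝ, ((NumberField.discr N).natAbs : ℝ) ^ L ≤ x →
              0 < x - x ^ β₁ / β₁ ∧
              |∑ t ∈ (orderOf σ).divisors, (ArithmeticFunction.moebius t : ℝ) / t *
                  degreeOneTheta (IntermediateField.fixedField (Subgroup.zpowers (σ ^ t))) x -
                (∑ t ∈ (orderOf σ).divisors, (ArithmeticFunction.moebius t : ℝ) / t) * (x - x ^ β₁ / β₁)| ≤
                ε * ((∑ t ∈ (orderOf σ).divisors, (ArithmeticFunction.moebius t : ℝ) / t) * (x - x ^ β₁ / β₁))) ∧
          (dedekindZeta₁ (IntermediateField.fixedField (Subgroup.zpowers σ)) β₁ ≠ 0 →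
            ∀ x : ℝ, ((NumberField.discr N).natAbs : ℝ) ^ L ≤ x →
              |∑ t ∈ (orderOf σ).divisors, (ArithmeticFunction.moebius t : ℝ) / t *
                  degreeOneTheta (IntermediateField.fixedField (Subgroup.zpowers (σ ^ t))) x -
                (∑ t ∈ (orderOf σ).divisors, (ArithmeticFunction.moebius t : ℝ) / t) * (x + x ^ β₁ / β₁)| ≤
                ε * ((∑ t ∈ (orderOf σ).divisors, (ArithmeticFunction.moebius t : ℝ) / t) * (x + x ^ β₁ / β₁)))) := by
  have hn0 : (0 : ℝ) < n := by exact_mod_cast (lt_trans Nat.zero_lt_one hn)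
  have hn1 : (1 : ℝ) ≤ n := by exact_mod_cast hn.le
  set η : ℝ := ε / (16 * (n : ℝ) ^ 3) with hη
  have hη0 : 0 < η := by positivity
  have hη1 : η ≤ 1 := by
    rw [hη, div_le_one (by positivity)]; nlinarith [pow_le_pow_left₀ zero_le_one hn1 3]
  obtain ⟨AU, hAU1, hU⟩ := chebyshevThetaIdeal_le_uniform_of_le n hη0
  obtain ⟨AD, hAD1, hD⟩ := chebyshevThetaIdeal_lower_dichotomy n hη0
  obtain ⟨AP, cP, hAP1, hcP, hP⟩ := chebyshevThetaIdeal_pointed_of_le n hη0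
  obtain ⟨X₁, hX₁1, hJ⟩ := chebyshevThetaIdeal_sub_degreeOneTheta_le_rpow n
  obtain ⟨x₀, hx₀2, hθQ⟩ := chebyshevTheta_eventually_abs hη0
  obtain ⟨c₀, hc₀, hLP⟩ := exists_exceptionalZero_const n
  obtain ⟨c₁, hc₁, hc₁1, hMT⟩ := exceptional_mainTerm_ge n hn
  set cstar : ℝ := min (min cP c₀) (1 / 4) with hcstar
  have hcstar0 : 0 < cstar := lt_min (lt_min hcP hc₀) (by norm_num)
  have hcP' : cstar ≤ cP := (min_le_left _ _).trans (min_le_left _ _)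
  have hc₀' : cstar ≤ c₀ := (min_le_left _ _).trans (min_le_right _ _)
  have hc4 : cstar ≤ 1 / 4 := min_le_right _ _
  obtain ⟨L₀, hL₀0, hW⟩ := rpow_div_le_of_ge_window hcstar0 hη0
  set e : ℝ := (1 : ℝ) + n * n with he
  set A : ℝ := max AU (max AD AP) with hA
  have hA1 : 1 ≤ A := le_trans hAU1 (le_max_left _ _)
  set X : ℝ := max (max X₁ x₀) (Real.exp 16) with hX
  have hX1 : 1 ≤ X := le_trans hX₁1 (le_trans (le_max_left _ _) (le_max_left _ _))
  obtain ⟨L, hLpos, hL1, hL2, hthr⟩ := division_thresholds_eps n hn L₀ hc₁ hc₁1 hX1 hA1 hε hε1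
  refine ⟨L, cstar, hLpos, hcstar0, hc4, fun N _ _ _ hN σ => ?_⟩
  have hN1 : 1 < Module.finrank ℚ N := by rw [hN]; exact hn
  set d : ℝ := ((NumberField.discr N).natAbs : ℝ) with hd
  have hd3 : (3 : ℝ) ≤ d := three_le_natAbs_discr_real N hN1
  obtain ⟨hd0, hd1⟩ : (0 : ℝ) < d ∧ (1 : ℝ) ≤ d := ⟨by linarith, by linarith⟩
  have hlogd0 : 0 < Real.log d := Real.log_pos (by linarith)
  set m : ℕ := orderOf σ with hm
  have hm0 : m ≠ 0 := (orderOf_pos σ).ne'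
  have hcardD : ((m.divisors).card : ℝ) ≤ n := by rw [← hN]; exact card_divisors_orderOf_le σ
  have hM : 1 / ((n : ℝ) ^ 2) ≤ ∑ t ∈ m.divisors, (ArithmeticFunction.moebius t : ℝ) / t :=
    sum_moebius_div_ge_inv_sq hN hn σ
  set E : ℕ → IntermediateField ℚ N := fun t => IntermediateField.fixedField (Subgroup.zpowers (σ ^ t))
    with hE
  have hfin : ∀ t, Module.finrank ℚ (E t) ≤ n := by
    intro t
    have h2 := Module.finrank_mul_finrank ℚ (E t) N
    rw [hN] at h2
    have hpos : 0 < Module.finrank (E t) N := Module.finrank_pos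
    exact le_of_le_of_eq (Nat.le_mul_of_pos_right _ hpos) h2
  have hdeg : ∀ t, Subgroup.zpowers (σ ^ t) ≠ ⊤ → 1 < Module.finrank ℚ (E t) := fun t ht =>
    one_lt_finrank_fixedField_of_ne_top _ ht
  have hAU : AU ≤ A := le_max_left _ _
  have hAD : AD ≤ A := le_trans (le_max_left _ _) (le_max_right _ _)
  have hAP : AP ≤ A := le_trans (le_max_right _ _) (le_max_right _ _)
  have hlogdN : ∀ t, Real.log ((NumberField.discr (E t)).natAbs : ℝ) ≤ Real.log d := by
    intro t
    have hdvd := NumberField.discr_dvd_discr (E t) N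
    have h1 : (1 : ℝ) ≤ ((NumberField.discr (E t)).natAbs : ℝ) := by
      have h := Int.one_le_abs (NumberField.discr_ne_zero (E t))
      rw [Int.abs_eq_natAbs] at h; exact_mod_cast h
    exact Real.log_le_log (by linarith) (by
      rw [hd]; exact_mod_cast Nat.le_of_dvd (Int.natAbs_pos.mpr (NumberField.discr_ne_zero N))
        (Int.natAbs_dvd_natAbs.mpr hdvd))
  have hμtop : ∀ t ∈ m.divisors, 1 < t → Subgroup.zpowers (σ ^ t) ≠ ⊤ := fun t ht h1 =>
    zpowers_pow_ne_top σ (Nat.dvd_of_mem_divisors ht) h1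
  have key : ∀ x : ℝ, d ^ L ≤ x →
      0 < x ∧ (∀ t, Subgroup.zpowers (σ ^ t) ≠ ⊤ → ∀ {a : ℝ}, 1 ≤ a → a ≤ A → ThornerZaman.condQn (E t) ^ a ≤ x) ∧
      (n : ℝ) * x ^ (3 / 4 : ℝ) ≤ ε * x / (4 * n ^ 2) ∧
      ((n : ℝ) ^ 2 + n) * Real.log d ≤ ε * x / (4 * n ^ 2) ∧
      (n : ℝ) * x ^ (3 / 4 : ℝ) ≤ ε * (x * c₁ / (4 * d ^ (2 * ((1 : ℝ) + n * n)))) / (4 * n ^ 2) ∧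
      1 < x ∧ 16 ≤ Real.log x ∧
      (∀ t, Subgroup.zpowers (σ ^ t) ≠ ⊤ → degreeOneTheta (E t) x ≤ (1 + η) * x) ∧
      (∀ t, chebyshevThetaIdeal (E t) x - x ^ (3 / 4 : ℝ) ≤ degreeOneTheta (E t) x) ∧
      (∀ t, Subgroup.zpowers (σ ^ t) = ⊤ → |degreeOneTheta (E t) x - x| ≤ η * x + Real.log d) ∧
      (∀ β : ℝ, 3 / 4 ≤ β → β ≤ 1 - cstar / (Real.log d + Real.log 4) → x ^ β / β ≤ η * x) ∧
      (∀ t, Subgroup.zpowers (σ ^ t) ≠ ⊤ →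
        (∀ β : ℝ, dedekindZeta₁ (E t) β = 0 → 3 / 4 ≤ β → β < 1 → β ≤ 1 - cstar / (Real.log d + Real.log 4)) →
        (1 - 2 * η) * x ≤ chebyshevThetaIdeal (E t) x) ∧
      (∀ β₁ : ℝ, 3 / 4 ≤ β₁ → β₁ < 1 → 1 - cstar / (Real.log d + Real.log 4) < β₁ →
        ∀ t, Subgroup.zpowers (σ ^ t) ≠ ⊤ → dedekindZeta₁ (E t) β₁ = 0 →
          0 < x - x ^ β₁ / β₁ ∧ |chebyshevThetaIdeal (E t) x - (x - x ^ β₁ / β₁)| ≤ η * (x - x ^ β₁ / β₁)) := by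
    intro x hx
    obtain ⟨hXx, hjunkA, hlogj, hj1, -⟩ := hthr d hd3 x hx
    have hx0 : 0 < x := lt_of_lt_of_le (Real.rpow_pos_of_pos hd0 L) hx
    have hX₁x : X₁ ≤ x := le_trans (le_trans (le_max_left _ _) (le_max_left _ _)) hXx
    have hx₀x : x₀ ≤ x := le_trans (le_trans (le_max_right _ _) (le_max_left _ _)) hXx
    have he16 : Real.exp 16 ≤ x := le_trans (le_max_right _ _) hXx
    have hx16 : 16 ≤ Real.log x := by
      have := Real.log_le_log (Real.exp_pos 16) he16; rwa [Real.log_exp] at this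
    have hx1 : 1 < x := by linarith [Real.add_one_le_exp (16 : ℝ)]
    have hQx : ∀ t, Subgroup.zpowers (σ ^ t) ≠ ⊤ → ∀ {a : ℝ}, 1 ≤ a → a ≤ A →
        ThornerZaman.condQn (E t) ^ a ≤ x := by
      intro t ht a ha haA
      exact (condQn_intermediateField_rpow_le hN hn (E t) (hdeg t ht) (by linarith) haA hL1).trans hx
    have hUp : ∀ t, Subgroup.zpowers (σ ^ t) ≠ ⊤ → degreeOneTheta (E t) x ≤ (1 + η) * x := fun t ht =>
      (degreeOneTheta_le_chebyshevThetaIdeal _ x).trans (hU (E t) (hdeg t ht) (hfin t) x (hQx t ht hAU1 hAU))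
    have hJt : ∀ t, chebyshevThetaIdeal (E t) x - x ^ (3 / 4 : ℝ) ≤ degreeOneTheta (E t) x := by
      intro t; have := hJ (E t) (hfin t) x hX₁x; linarith
    have hTop : ∀ t, Subgroup.zpowers (σ ^ t) = ⊤ → |degreeOneTheta (E t) x - x| ≤ η * x + Real.log d := by
      intro t ht
      have hall : ∀ g, g ∈ Subgroup.zpowers (σ ^ t) := fun g => by rw [ht]; exact Subgroup.mem_top g
      have h1 := degreeOneTheta_fixedField_ge_of_forall_mem (Subgroup.zpowers (σ ^ t)) hall x
      have h2 := degreeOneTheta_fixedField_le_theta_of_forall_mem (Subgroup.zpowers (σ ^ t)) hall x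
      have h3 := hθQ x hx₀x
      rw [abs_le]; constructor <;> linarith [h3.1, h3.2]
    have hout : ∀ β : ℝ, 3 / 4 ≤ β → β ≤ 1 - cstar / (Real.log d + Real.log 4) → x ^ β / β ≤ η * x := by
      intro β hβ hβc
      have hL₀x : d ^ L₀ ≤ x := (Real.rpow_le_rpow_of_exponent_le hd1 hL2).trans hx
      exact hW d hd3 x hL₀x β (by linarith) hβc
    have hLow : ∀ t, Subgroup.zpowers (σ ^ t) ≠ ⊤ →
        (∀ β : ℝ, dedekindZeta₁ (E t) β = 0 → 3 / 4 ≤ β → β < 1 → β ≤ 1 - cstar / (Real.log d + Real.log 4)) →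
        (1 - 2 * η) * x ≤ chebyshevThetaIdeal (E t) x := by
      intro t ht hzero
      rcases hD (E t) (hdeg t ht) (hfin t) with h1 | ⟨β, hζ, hβ34, hβ1, h2⟩
      · have := h1 x (hQx t ht hAD1 hAD); nlinarith
      · have hb := h2 x (hQx t ht hAD1 hAD)
        have hs := hout β hβ34 (hzero β hζ hβ34 hβ1)
        have hprod := mul_le_mul_of_nonneg_left hs (by linarith : 0 ≤ 1 - η)
        have hsq : 0 ≤ η * (η * x) := by positivity
        have e : (1 - η) * (x - x ^ β / β) = (1 - η) * x - (1 - η) * (x ^ β / β) := by ring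
        have e' : (1 - η) * (η * x) = η * x - η * (η * x) := by ring
        linarith
    have hPt : ∀ β₁ : ℝ, 3 / 4 ≤ β₁ → β₁ < 1 → 1 - cstar / (Real.log d + Real.log 4) < β₁ →
        ∀ t, Subgroup.zpowers (σ ^ t) ≠ ⊤ → dedekindZeta₁ (E t) β₁ = 0 →
          0 < x - x ^ β₁ / β₁ ∧ |chebyshevThetaIdeal (E t) x - (x - x ^ β₁ / β₁)| ≤ η * (x - x ^ β₁ / β₁) := by
      intro β₁ hβ34 hβ₁1 hβ₁c t htop hζt
      have hβ0 : 0 < β₁ := by linarith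
      have hlog4 : 0 < Real.log 4 := Real.log_pos (by norm_num)
      have hwin : 1 - cP / (Real.log ((NumberField.discr (E t)).natAbs : ℝ) + Real.log 4) < β₁ := by
        have hlt : 0 ≤ Real.log ((NumberField.discr (E t)).natAbs : ℝ) := Real.log_natCast_nonneg _
        have h1 : cstar / (Real.log d + Real.log 4) ≤
            cP / (Real.log ((NumberField.discr (E t)).natAbs : ℝ) + Real.log 4) := by
          rw [div_le_div_iff₀ (by linarith) (by linarith)]
          have := hlogdN t
          nlinarith [hcstar0, hcP]
        linarith
      exact hP (E t) (hdeg t htop) (hfin t) β₁ hζt hβ0 hβ₁1 hwin x (hQx t htop hAP1 hAP)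
    exact ⟨hx0, hQx, hjunkA, hlogj, hj1, hx1, hx16, hUp, hJt, hTop, hout, hLow, hPt⟩
  refine ⟨?_, ?_⟩
  · -- CASE A: no exceptional zero — main term `M x`
    intro hexc x hx
    obtain ⟨hx0, -, hjunkA, hlogj, -, -, -, hUp, hJt, hTop, -, hLow, -⟩ := key x hx
    have hx34 : 0 ≤ x ^ (3 / 4 : ℝ) := Real.rpow_nonneg hx0.le _
    have hterm : ∀ t ∈ m.divisors, |degreeOneTheta (E t) x - x| ≤ 2 * η * x + x ^ (3 / 4 : ℝ) + Real.log d := by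
      intro t _
      by_cases htop : Subgroup.zpowers (σ ^ t) = ⊤
      · have := hTop t htop
        have hηx : 0 ≤ η * x := by positivity
        linarith
      · have h1 := hLow t htop (fun β hζ _ hβ1 => subfield_realZero_le_of_no_exceptional hexc (E t) hβ1 hζ)
        have h2 := hJt t
        have h3 := hUp t htop
        rw [abs_le]; constructor <;> linarith
    have hsum := abs_sum_moebius_div_mul_sub_le m (fun t => degreeOneTheta (E t) x) (fun _ => x) hterm
    have hmain : ∑ t ∈ m.divisors, (ArithmeticFunction.moebius t : ℝ) / t * x =
        (∑ t ∈ m.divisors, (ArithmeticFunction.moebius t : ℝ) / t) * x := (Finset.sum_mul _ _ _).symm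
    rw [hmain] at hsum
    refine hsum.trans ?_
    have hErr0 : 0 ≤ 2 * η * x + x ^ (3 / 4 : ℝ) + Real.log d := by positivity
    calc (m.divisors.card : ℝ) * (2 * η * x + x ^ (3 / 4 : ℝ) + Real.log d)
        ≤ n * (2 * η * x + x ^ (3 / 4 : ℝ) + Real.log d) := mul_le_mul_of_nonneg_right hcardD hErr0
      _ = n * (2 * (ε / (16 * n ^ 3)) * x + x ^ (3 / 4 : ℝ) + Real.log d) := by rw [hη]
      _ ≤ ε * ((∑ t ∈ m.divisors, (ArithmeticFunction.moebius t : ℝ) / t) * x) :=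
          division_conclusion_main hn hε hx0 le_rfl hM hjunkA hlogj hlogd0.le
  · -- CASE B: the exceptional zero `β₁`
    intro β₁ hζ₁ hβ₁c hβ₁1
    have hlog4 : 0 < Real.log 4 := Real.log_pos (by norm_num)
    have hβ34 : 3 / 4 ≤ β₁ := by
      have : cstar / (Real.log d + Real.log 4) ≤ 1 / 4 := by
        rw [div_le_iff₀ (by linarith)]
        have hlog4' : 1 < Real.log 4 := by
          rw [show (4:ℝ) = 2 ^ 2 by norm_num, Real.log_pow]; have := Real.log_two_gt_d9; push_cast; linarith
        nlinarith
      linarith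
    have hβ0 : 0 < β₁ := by linarith
    -- Heilbronn–Stark
    obtain ⟨K₁, hK₁, hHS⟩ := exists_index_two_of_exceptional hN1 hc4 hζ₁ hβ₁c hβ₁1
    have hK₁top : K₁ ≠ ⊤ := by
      intro h; rw [h, Subgroup.index_top] at hK₁; norm_num at hK₁
    have hE1 : IntermediateField.fixedField (Subgroup.zpowers σ) = E 1 := by
      simp only [hE, pow_one]
    refine ⟨?_, ?_⟩
    · -- CASE B1: `σ ∈ K₁` — every `E_t` carries `β₁`; main term `M (x − y)`
      intro hζσ x hx
      obtain ⟨hx0, -, -, -, hj1, hx1, hx16, -, hJt, -, -, -, hPt⟩ := key x hx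
      have hσK : σ ∈ K₁ := by
        have h := (hHS (Subgroup.zpowers σ)).mp hζσ
        exact h (Subgroup.mem_zpowers σ)
      have hall : ∀ t, Subgroup.zpowers (σ ^ t) ≤ K₁ := fun t =>
        Subgroup.zpowers_le.mpr (K₁.pow_mem hσK t)
      have hnt : ∀ t, Subgroup.zpowers (σ ^ t) ≠ ⊤ := fun t h => hK₁top (top_le_iff.mp (h ▸ hall t))
      set y : ℝ := x ^ β₁ / β₁ with hy
      have hPt' : ∀ t, 0 < x - y ∧ |chebyshevThetaIdeal (E t) x - (x - y)| ≤ η * (x - y) := fun t =>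
        hPt β₁ hβ34 hβ₁1 hβ₁c t (hnt t) ((hHS _).mpr (hall t))
      have hxy : 0 < x - y := (hPt' 1).1
      refine ⟨hxy, ?_⟩
      have hx34 : 0 ≤ x ^ (3 / 4 : ℝ) := Real.rpow_nonneg hx0.le _
      have hterm : ∀ t ∈ m.divisors, |degreeOneTheta (E t) x - (x - y)| ≤ η * (x - y) + x ^ (3 / 4 : ℝ) := by
        intro t _
        obtain ⟨-, hb⟩ := hPt' t
        have h2 := hJt t
        have h3 := degreeOneTheta_le_chebyshevThetaIdeal (E t) x
        rw [abs_le] at hb ⊢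
        constructor <;> linarith [hb.1, hb.2]
      have hsum := abs_sum_moebius_div_mul_sub_le m (fun t => degreeOneTheta (E t) x) (fun _ => x - y) hterm
      have hmain : ∑ t ∈ m.divisors, (ArithmeticFunction.moebius t : ℝ) / t * (x - y) =
          (∑ t ∈ m.divisors, (ArithmeticFunction.moebius t : ℝ) / t) * (x - y) := (Finset.sum_mul _ _ _).symm
      rw [hmain] at hsum
      refine hsum.trans ?_
      -- `x − y ≥ W = x c₁ / (4 d^{2e})` (Stark)
      have hWxy : x * c₁ / (4 * d ^ (2 * ((1 : ℝ) + n * n))) ≤ x - y := hMT N hN β₁ hζ₁ hβ34 hβ₁1 x hx1 hx16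
      have hErr0 : 0 ≤ η * (x - y) + x ^ (3 / 4 : ℝ) := by positivity
      calc (m.divisors.card : ℝ) * (η * (x - y) + x ^ (3 / 4 : ℝ))
          ≤ n * (η * (x - y) + x ^ (3 / 4 : ℝ)) := mul_le_mul_of_nonneg_right hcardD hErr0
        _ = n * (ε / (16 * n ^ 3) * (x - y) + x ^ (3 / 4 : ℝ)) := by rw [hη]
        _ ≤ ε * ((∑ t ∈ m.divisors, (ArithmeticFunction.moebius t : ℝ) / t) * (x - y)) :=
            division_conclusion_exc hn hε hxy hWxy hM hj1
    · -- CASE B2: `σ ∉ K₁` — `E_t` carries `β₁` iff `t` is even; main term `M (x + y)`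
      intro hζσ x hx
      obtain ⟨hx0, -, hjunkA, hlogj, -, -, -, hUp, hJt, hTop, hout, hLow, hPt⟩ := key x hx
      have hσK : σ ∉ K₁ := fun h => hζσ ((hHS (Subgroup.zpowers σ)).mpr (Subgroup.zpowers_le.mpr h))
      have hcarry : ∀ t, Subgroup.zpowers (σ ^ t) ≤ K₁ ↔ Even t := fun t => by
        rw [Subgroup.zpowers_le, pow_mem_iff_even_of_index_two hK₁ hσK]
      have hmeven : 2 ∣ m := by
        have : σ ^ m ∈ K₁ := by rw [hm, pow_orderOf_eq_one]; exact K₁.one_mem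
        exact even_iff_two_dvd.mp ((pow_mem_iff_even_of_index_two hK₁ hσK m).mp this)
      set y : ℝ := x ^ β₁ / β₁ with hy
      have hy0 : 0 ≤ y := div_nonneg (Real.rpow_nonneg hx0.le _) hβ0.le
      have hx34 : 0 ≤ x ^ (3 / 4 : ℝ) := Real.rpow_nonneg hx0.le _
      have hterm : ∀ t ∈ m.divisors,
          |degreeOneTheta (E t) x - (x - (if Even t then 1 else 0) * y)| ≤
            2 * η * x + x ^ (3 / 4 : ℝ) + Real.log d := by
        intro t _
        have hηx : 0 ≤ η * x := by positivity
        by_cases htop : Subgroup.zpowers (σ ^ t) = ⊤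
        · -- the degree-one field: `t` is odd (else `G = ⟨σ^t⟩ ≤ K₁`)
          have hodd : ¬ Even t := fun hev => hK₁top (top_le_iff.mp (htop ▸ (hcarry t).mpr hev))
          rw [if_neg hodd, zero_mul, sub_zero]
          have := hTop t htop
          linarith
        · by_cases hev : Even t
          · rw [if_pos hev, one_mul]
            obtain ⟨hxy, hb⟩ := hPt β₁ hβ34 hβ₁1 hβ₁c t htop ((hHS _).mpr ((hcarry t).mpr hev))
            have h2 := hJt t
            have h3 := degreeOneTheta_le_chebyshevThetaIdeal (E t) x
            have hηxy : η * (x - y) ≤ η * x := mul_le_mul_of_nonneg_left (by linarith) hη0.le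
            rw [abs_le] at hb ⊢
            constructor <;> linarith [hb.1, hb.2]
          · rw [if_neg hev, zero_mul, sub_zero]
            have hne : dedekindZeta₁ (E t) β₁ ≠ 0 := fun h => hev ((hcarry t).mp ((hHS _).mp h))
            have h1 := hLow t htop (fun β hζ _ hβ1 =>
              subfield_realZero_le_of_ne hN hc₀' hLP hζ₁ hβ₁c (E t) hne hβ1 hζ)
            have h2 := hJt t
            have h3 := hUp t htop
            rw [abs_le]; constructor <;> linarith
      have hsum := abs_sum_moebius_div_mul_sub_le m (fun t => degreeOneTheta (E t) x)
        (fun t => x - (if Even t then 1 else 0) * y) hterm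
      have hmain : ∑ t ∈ m.divisors, (ArithmeticFunction.moebius t : ℝ) / t * (x - (if Even t then 1 else 0) * y) =
          (∑ t ∈ m.divisors, (ArithmeticFunction.moebius t : ℝ) / t) * (x + y) := by
        have hsplit : ∀ t ∈ m.divisors, (ArithmeticFunction.moebius t : ℝ) / t * (x - (if Even t then 1 else 0) * y) =
            (ArithmeticFunction.moebius t : ℝ) / t * x -
              (ArithmeticFunction.moebius t : ℝ) / t * (if Even t then 1 else 0) * y := fun t _ => by ring
        rw [Finset.sum_congr rfl hsplit, Finset.sum_sub_distrib, ← Finset.sum_mul, ← Finset.sum_mul,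
          sum_moebius_div_ite_even_eq_neg m hmeven hm0]
        ring
      rw [hmain] at hsum
      refine hsum.trans ?_
      have hErr0 : 0 ≤ 2 * η * x + x ^ (3 / 4 : ℝ) + Real.log d := by positivity
      calc (m.divisors.card : ℝ) * (2 * η * x + x ^ (3 / 4 : ℝ) + Real.log d)
          ≤ n * (2 * η * x + x ^ (3 / 4 : ℝ) + Real.log d) := mul_le_mul_of_nonneg_right hcardD hErr0
        _ = n * (2 * (ε / (16 * n ^ 3)) * x + x ^ (3 / 4 : ℝ) + Real.log d) := by rw [hη]
        _ ≤ ε * ((∑ t ∈ m.divisors, (ArithmeticFunction.moebius t : ℝ) / t) * (x + y)) :=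
            division_conclusion_main hn hε hx0 (by linarith) hM hjunkA hlogj hlogd0.le

end Summit.QuantumAdvantage.QuantumAdvantage.Theorems.DegreeOnePrimesEscape

end
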